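import Summits.BirchSwinnertonDyer.BirchSwinnertonDyer.Theorems.ThetaPartnerAtTwoSignedControlAtTwoShaTwoPrimaryVanishing
import Summits.BirchSwinnertonDyer.BirchSwinnertonDyer.Theorems.ThetaPartnerAtTwoSignedControlAtTwoNoFiniteSubmoduleOfShaTwo
import Literature.NumberTheory.EllipticCurves.IwasawaTowerTorsionProofs
import HarnessLib

/-!
# `Ш²(K, E[p^∞]) = 0`, DIV «`(γ−1)·H¹(K_∞, E[p^∞]) = H¹(K_∞, E[p^∞])`» and «no finite `Λ`-submodule» for every
# TOTALLY REAL `K`, every `p`, every `ℤ_p`-extension — modulo the three generic Poitou–Tate rows only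
# (crux K4 `SignedControlAtTwo`, stmt-BirchSwinnertonDyer-20309, PROP412-BYPASS × w2's part 4b, joined)

Route `ThetaPartnerAtTwo` (TP2; crux shared with `ResidualThetaTransportAtTwo`), crux K4, memo
`Cruxes/SignedControlAtTwo/PROP412-BYPASS.md` (seat `bsd-inputs-k4-p1`). THEOREMS ONLY (no definition, no named
fact, no `sorry`); the three Poitou–Tate rows enter as HYPOTHESES BY NAME (conditional results).

Width seat w2 g5 proved (`…ShaTwoPrimaryVanishing`, `SignedEC.ShaTwo.forall_mem_shaTwo_primary_eq_zero`): for `K`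
totally real, `Ш²(K, E[p^∞]) = 0` granted `poitouTate_sha_tateDual K` (Milne I 4.10 (a)),
`poitouTate_three_realPlaces_injective K` (4.10 (c), `r = 3`), `poitouTate_two_realPlaces_surjective K` (Cor. 4.16),
`Sel_{p^∞}(E/K)` finite, `E[p^∞]^{Γ_K} = 0`, AND the local vanishing `hfin : H²(K_v, E[p^∞]) = 0` at every finite `v`
— discharging `hfin` only over `ℚ` on the good-supersingular row.  This seat's `…LocalHTwoPrimaryTorsion`
(`subsingleton_galoisCohomology_two_toLocal_primaryTorsion`) proves `hfin` for EVERY number field, prime and curve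
(Tate local duality + `cd_p(Γ_{K_v}) ≤ 2` + divisibility of `E[p^∞]`).  Joining the two, and then this seat's
`…DivOfShaTwoAnyField` / `…NoFiniteSubmoduleOfShaTwo`:

* `forall_mem_shaTwo_primary_eq_zero_of_poitouTate`, `shaTwo_primary_eq_bot_of_poitouTate` — **`Ш²(K, E[p^∞]) = 0`**
  for `K` totally real, any `p`, any elliptic `W/K` with `Sel_{p^∞}(E/K)` finite and `E(K)[p] = 0`
  (`hK : ∀ P, p • P = 0 → P = 0`, which gives `E[p^∞]^{Γ_K} = 0` by `WeierstrassCurve.eq_zero_of_forall_smul_eq`),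
  modulo the three rows;
* `forall_exists_conjH1_sub_eq_of_poitouTate` — **DIV**: every class of `H¹(Gal(K̄/K_∞), E[p^∞])` is `conj_γ t − t`,
  for every `ℤ_p`-extension `κ` of such a `K` and topological generator `γ` — the `hdiv` input of the line's doors
  `signedEndCoinvariants_subsingleton_of_ambient` (K4) / `sharpFlatEndCoinvariants_subsingleton_of_ambient` (19097);
* `dual_forall_finite_eq_bot_of_poitouTate` — the Pontryagin dual of `H¹(K_∞, E[p^∞])` has **no nonzero finite
  `Λ`-submodule** (Greenberg's Prop. 4.9 / 4.12 conclusion for the full group), same hypotheses;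
* `forall_exists_conjH1_sub_eq_two_of_goodSS_of_poitouTate` — the K4 / 19097 row: `K = ℚ`, `p = 2`, `W` globally
  minimal with good supersingular reduction at `2`, `Sel_{2^∞}(E/ℚ)` finite, ANY `ℤ₂`-extension: DIV modulo the three
  rows over `ℚ` (no Greenberg print, no Prop. 4.12, no corank / weak-Leopoldt / Kato input).

So on every totally real row the inputs «Prop. 4.12», «`corank_Λ H¹(K_Σ/K_∞, E[p^∞]) = [K:ℚ]`» and «weak Leopoldt» of
Greenberg 1999 are replaced by three generic class-field-theory statements (outputs of the class-formation road).
BSD is not proved by any of this; no summit statement is proved by this seat; closes no item by itself.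

References: [MilneADT2006] I Thm. 4.10 (a),(c), Cor. 4.16, Thm. 6.13 (c); [GreenbergLNM1716] §4 Appendix Prop. 4.9,
4.10, 4.12 (pp. 113–119); [Harari2020] Prop. A.66, §17.3.
-/

set_option autoImplicit false
-- the Theorems namespace of this sub repeats the summit name by design (D-0017 nested layout)
set_option linter.dupNamespace false

noncomputable section

open scoped Classical NumberField

namespace Summit.BirchSwinnertonDyer.BirchSwinnertonDyer.Theorems.SignedEC.PrimaryTorsionH2

open Function NumberField IsDedekindDomain Field WeierstrassCurve
open Literature.NumberTheory.EllipticCurves Literature.NumberTheory.GaloisRepresentations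
  Literature.NumberTheory.GaloisCohomology Literature.NumberTheory.EllipticCurves.IwasawaAlgebra
open Literature.NumberTheory.GaloisRepresentations.DiscreteGaloisModule (shaTwo)
open Summit.BirchSwinnertonDyer.Rank1Residual.X11b

section TotallyReal

variable {K : Type} [Field K] [NumberField K] (W : WeierstrassCurve K) [W.IsElliptic]
  (p : ℕ) [hp : Fact p.Prime]

/-- **`Ш²(K, E[p^∞]) = 0` for `K` totally real** — w2's `SignedEC.ShaTwo.forall_mem_shaTwo_primary_eq_zero` with its
local hypothesis `hfin : H²(K_v, E[p^∞]) = 0` (every finite `v`) DISCHARGED for every number field by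
`subsingleton_galoisCohomology_two_toLocal_primaryTorsion`; remaining inputs: the three Poitou–Tate rows by name,
`Sel_{p^∞}(E/K)` finite, `E[p^∞]^{Γ_K} = 0`.
[cite: MilneADT2006, Ch. I, Thm. 4.10 (a),(c), Cor. 4.16, Thm. 6.13 (c)] -/
theorem forall_mem_shaTwo_primary_eq_zero_of_poitouTate [IsTotallyReal K] (hPT : poitouTate_sha_tateDual K)
    (h3 : poitouTate_three_realPlaces_injective K) (h2 : poitouTate_two_realPlaces_surjective K)
    [Finite (W.selmerGroupPInfty p)]
    (hΓ : ∀ Q : W.geomPrimaryTorsion p,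
      (∀ σ : absoluteGaloisGroup K, LocBridge.primaryGaloisModule W p σ Q = Q) → Q = 0) :
    ∀ c ∈ shaTwo (LocBridge.primaryGaloisModule W p), c = 0 :=
  ShaTwo.forall_mem_shaTwo_primary_eq_zero W p hPT h3 h2
    (fun v Z ↦ by
      haveI := subsingleton_galoisCohomology_two_toLocal_primaryTorsion W p v
        (LocBridge.primaryGaloisModule W p) (fun _ _ ↦ rfl)
      exact Subsingleton.elim _ _) hΓ

/-- **`Ш²(K, E[p^∞]) = ⊥` for `K` totally real, `Sel_{p^∞}(E/K)` finite and `E(K)[p] = 0`** (the latter as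
`hK : ∀ P, p • P = 0 → P = 0`, giving `E[p^∞]^{Γ_K} = 0` by `WeierstrassCurve.eq_zero_of_forall_smul_eq`), modulo the
three Poitou–Tate rows by name. [cite: MilneADT2006, Ch. I, Thm. 4.10 (a),(c), Cor. 4.16, Thm. 6.13 (c)] -/
theorem shaTwo_primary_eq_bot_of_poitouTate [IsTotallyReal K] (hPT : poitouTate_sha_tateDual K)
    (h3 : poitouTate_three_realPlaces_injective K) (h2 : poitouTate_two_realPlaces_surjective K)
    [Finite (W.selmerGroupPInfty p)] (hK : ∀ P : W.toAffine.Point, p • P = 0 → P = 0) :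
    shaTwo (LocBridge.primaryGaloisModule W p) = ⊥ := by
  rw [eq_bot_iff]
  intro c hc
  rw [AddSubgroup.mem_bot]
  exact forall_mem_shaTwo_primary_eq_zero_of_poitouTate W p hPT h3 h2
    (fun Q hQ ↦ W.eq_zero_of_forall_smul_eq (p := p) hK fun σ ↦ hQ σ) c hc

variable (κ : ZpExtension K p) {γ : absoluteGaloisGroup K}

/-- **DIV for `K` totally real, modulo the three Poitou–Tate rows**: for every `ℤ_p`-extension `κ` of a totally real
`K`, topological generator `γ`, and elliptic `W/K` with `Sel_{p^∞}(E/K)` finite and `E(K)[p] = 0`, every class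
`s ∈ H¹(Gal(K̄/K_∞), E[p^∞])` is `conj_γ t − t` (`forall_exists_conjH1_sub_eq_of_shaTwo_eq_bot` ∘
`shaTwo_primary_eq_bot_of_poitouTate`) — the `hdiv` input of the ambient-coinvariant doors, with NO Greenberg-1999
input. [cite: GreenbergLNM1716, §4 Appendix Prop. 4.10, Prop. 4.12 (pp. 116–119)]
[cite: MilneADT2006, Ch. I, Thm. 4.10, Cor. 4.16, Thm. 6.13 (c)] -/
theorem forall_exists_conjH1_sub_eq_of_poitouTate [IsTotallyReal K] (hγ : κ.IsTopGenerator γ)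
    (hPT : poitouTate_sha_tateDual K) (h3 : poitouTate_three_realPlaces_injective K)
    (h2 : poitouTate_two_realPlaces_surjective K) [Finite (W.selmerGroupPInfty p)]
    (hK : ∀ P : W.toAffine.Point, p • P = 0 → P = 0) (s : W.subgroupH1 p κ.kerSubgroup) :
    ∃ t : W.subgroupH1 p κ.kerSubgroup, W.conjH1 p κ.kerSubgroup γ t - t = s :=
  forall_exists_conjH1_sub_eq_of_shaTwo_eq_bot W p κ hγ (shaTwo_primary_eq_bot_of_poitouTate W p hPT h3 h2 hK) s

/-- **No nonzero finite `Λ`-submodule in the Pontryagin dual of `H¹(K_∞, E[p^∞])`, `K` totally real, modulo the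
three Poitou–Tate rows** (Greenberg's Prop. 4.9 / 4.12 conclusion for the full group `H¹(Gal(K̄/K_∞), E[p^∞])`):
for every `Λ`-module `Y` mapped injectively into `Hom(H¹(K_∞, E[p^∞]), ℚ/ℤ)` with `T` acting as `conj_γ − 1`.
[cite: GreenbergLNM1716, §4 Appendix Prop. 4.9 (p. 113), Prop. 4.12 (p. 119)] [cite: Washington1997, §13.2] -/
theorem dual_forall_finite_eq_bot_of_poitouTate [IsTotallyReal K] (hγ : κ.IsTopGenerator γ)
    (hPT : poitouTate_sha_tateDual K) (h3 : poitouTate_three_realPlaces_injective K)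
    (h2 : poitouTate_two_realPlaces_surjective K) [Finite (W.selmerGroupPInfty p)]
    (hK : ∀ P : W.toAffine.Point, p • P = 0 → P = 0)
    {Y : Type*} [AddCommGroup Y] [Module (IwasawaAlgebra p) Y]
    (dY : Y →+ (W.subgroupH1 p κ.kerSubgroup →+ AddCircle (1 : ℚ))) (hinj : Function.Injective dY)
    (hT : ∀ (y : Y) (x : W.subgroupH1 p κ.kerSubgroup),
      dY ((PowerSeries.X : IwasawaAlgebra p) • y) x = dY y (W.conjH1 p κ.kerSubgroup γ x) - dY y x) :
    ∀ N : Submodule (IwasawaAlgebra p) Y, Finite N → N = ⊥ :=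
  dual_forall_finite_eq_bot_of_shaTwo_eq_bot W p κ hγ (shaTwo_primary_eq_bot_of_poitouTate W p hPT h3 h2 hK)
    dY hinj hT

end TotallyReal

section Rat

variable (W : WeierstrassCurve ℚ) [W.IsElliptic] [W.IsGloballyMinimal] (κ : ZpExtension ℚ 2)
  {γ : absoluteGaloisGroup ℚ}

/-- **DIV on the K4 / 19097 row, modulo the three Poitou–Tate rows over `ℚ`**: for `W/ℚ` globally minimal with
good supersingular reduction at `2` and `Sel_{2^∞}(E/ℚ)` finite, ANY `ℤ₂`-extension `κ` and topological generator
`γ`, every class of `H¹(Gal(ℚ̄/ℚ_∞), E[2^∞])` is `conj_γ t − t` — from w2's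
`SignedEC.ShaTwo.forall_mem_shaTwo_two_primary_eq_zero_of_goodSS` and `forall_exists_conjH1_sub_eq_of_shaTwo_eq_bot`.
This is the `hdiv` input of `signedEndCoinvariants_subsingleton_of_ambient` (K4) and of
`sharpFlatEndCoinvariants_subsingleton_of_ambient` (19097 COUNT♭@2) with no Greenberg-1999 / Kato input.
[cite: GreenbergLNM1716, §4 Appendix Prop. 4.12 (p. 119)] [cite: MilneADT2006, Ch. I, Thm. 4.10, Cor. 4.16, Thm. 6.13 (c)] -/
theorem forall_exists_conjH1_sub_eq_two_of_goodSS_of_poitouTate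
    (hss : Literature.NumberTheory.EllipticCurves.Rank1Residual.GoodSS W 2) (hγ : κ.IsTopGenerator γ)
    (hPT : poitouTate_sha_tateDual ℚ) (h3 : poitouTate_three_realPlaces_injective ℚ)
    (h2 : poitouTate_two_realPlaces_surjective ℚ) [Finite (W.selmerGroupPInfty 2)]
    (s : W.subgroupH1 2 κ.kerSubgroup) :
    ∃ t : W.subgroupH1 2 κ.kerSubgroup, W.conjH1 2 κ.kerSubgroup γ t - t = s := by
  refine forall_exists_conjH1_sub_eq_of_shaTwo_eq_bot W 2 κ hγ ?_ s
  rw [eq_bot_iff]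
  intro c hc
  rw [AddSubgroup.mem_bot]
  exact ShaTwo.forall_mem_shaTwo_two_primary_eq_zero_of_goodSS W hss hPT h3 h2 c hc

end Rat

end Summit.BirchSwinnertonDyer.BirchSwinnertonDyer.Theorems.SignedEC.PrimaryTorsionH2

end
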